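import Summits.QuantumFields.BalabanUV.Beta.GreenGradientRowSum

/-!
# Beta / GradientMemberBox — THE GRADIENT MEMBER (3.42)₂'s SHAPE ON A TORUS BOX FOR THE FLAT LAPLACIAN, IN THE KERNEL:
# `|f(x₀ + e_μ) − f(x₀)| ≤ K_d·max_B|f|∕(R+1) + K₂·(R+1)·max_B|W·f − Nf|` on the ball `B = {dist(·,x₀) ≤ 2R+2}` — one power of the radius
# below the sup member (DG4 `fibreNorm_le_box`: `max|f| + (R+1)²·max|Lf|`), modulo ONE pointwise Green bound (d = 4: road P3)
# (third module of the chain «LATTICE-GRADIENT-MEMBER»: O.2 item (i), the gradient member, at MODEL level)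

WHAT IS CERTIFIED (kernel, 0 sorry).
* §1 (generic bond structure `src, tgt : Bd → St`, weights `c`, finite `B` with a nonnegative unit supersolution `w₀` — road P3's `dirSol`
  setting): **`abs_dirSol_le`** (`|g| ≤ m′` on `B` ⟹ `|dirSol B g| ≤ m′·w₀`, two comparisons with `GraphHarmonicExtension.
  nonpos_of_subsolution_unit`), **`dirSol_eq_sum_green`** (`dirSol B g x = Σ_{y ∈ B} g(y)·green B x y`: `dirSol_sum` + `dirSol_unique`),
  `sub_dirSol_harmonic` (`f − dirSol B (W·f − Nf)` is harmonic on `B`).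
* §2 (unit torus, constant weight `c ≡ c₀ ≠ 0`, flat transport) **`fdiff_le_box`** — `R ≥ 1`, `10R + 4 ≤ N_i`, `B = ball(x₀, 2R+2)`, the
  pointwise Green hypothesis `green B x′ y ≤ K·((dist x′ y + 1)^{d−2})⁻¹`, `|f| ≤ M` and `|W·f − Nf| ≤ m′` on `B` ⟹
  **`|f(x₀+e_μ) − f(x₀)| ≤ K_d·M∕(R+1) + ((9/2)·K_d∕c₀² + 12·C₁·C_ps·K)·(R+1)·m′`** — split `f = f_h + dirSol_B(W·f − Nf)`: GR1
  `harmonic_fdiff_le` on the harmonic part (its size `≤ M + m′(2R+3)²∕(2c₀²)` by §1 and an4's `exists_unit_supersolution_box`), GR2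
  `sum_abs_fdiff_green_le` on the potential part (`D = 2R+2`, `ρ = R`).  For `d = 4` the hypothesis is road P3's Newton-potential bound.
(unit `b2b-balaban-beta-d4-p2`, GEN 11, MODEL crew; claim «LATTICE-GRADIENT-MEMBER» journal l.23681.)

HONEST FRAMING: discharging `BetaPertH` makes Bałaban's UV stability UNCONDITIONAL — NOT the continuum limit, NOT the Clay problem.
HONEST DEPENDENCY (verbatim): «continuum YM on T⁴ ⇐ BetaPertH ∧ nine spine estimates (0/9 proved); BetaPertH ⇐ (D1) ∧ (D4) ∧ CAP+tail;
G-an2-4 gates asym, D1 and NE2/3/4.»  THIS MODULE DISCHARGES NOTHING of `BetaPertH`, asserts NOTHING printed and cites nothing as a fact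
(ABSOLUTE RULE): [folklore] discrete potential theory of the FREE torus Laplacian (constant weight, U = 1); the multi-region operator's gradient
member (averaging part as source, scale-adapted balls) is the OWNER's assembly, not claimed here; for a covariant Laplacian with arbitrary bond
matrices there is NO gradient member at MODEL level (translation fails); print's (3.42)₂ is [B4] Lemma 2.2's (p,q)-chain — NOT reproduced.
LOCATORS (shape only): [Balaban1985BackgroundPropagators] Thm 3.1 (3.42) p. 397; [Balaban1983RegularityDecay] Lemma 2.2 (2.17) p. 577.
No class change on row D4 (critical-path width 0; D4 DISCHARGE NO DATE); NOT BetaPertH, NOT continuum, NOT Clay, NOT summit progress.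
-/

open scoped BigOperators
open Finset

namespace Summit.QuantumFields.BalabanUV.Beta.GradientMemberBox

open Literature.MathematicalPhysics.QuantumFieldTheory.Balaban1983to89
open Literature.MathematicalPhysics.QuantumFieldTheory.Balaban1983to89.B9Thm37GluePU (bsrc btgt)
open B5TorusCover (UT)
open B5Leibniz121 (up)
open Summit.QuantumFields.BalabanUV.Beta.SubsolutionMeanValue (nb_sub nb_smul)
open Summit.QuantumFields.BalabanUV.Beta.GraphHarmonicExtension (nonpos_of_subsolution_unit)
open Summit.QuantumFields.BalabanUV.Beta.GraphGreenFunction (dirSol green dirSol_eq_on dirSol_eq_off dirSol_unique dirSol_sum)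
open Summit.QuantumFields.BalabanUV.Beta.TorusBoxSupersolution (exists_unit_supersolution_box)
open Summit.QuantumFields.BalabanUV.Beta.HarmonicGradientInterior (Kgrad harmonic_fdiff_le dist_up_le_add_one)
open Summit.QuantumFields.BalabanUV.Beta.TorusInversePowerSums (Cps Cps_nonneg)
open Summit.QuantumFields.BalabanUV.Beta.GreenGradientRowSum (Cdip Cdip_nonneg Kgrad_nonneg sum_abs_fdiff_green_le)

noncomputable section

/-! ## §1 Generic: size of the Dirichlet potential, its Green representation, the harmonic remainder -/

section Generic

variable {St Bd : Type} [Fintype St] [Fintype Bd] [DecidableEq St] (src tgt : Bd → St) (c : Bd → ℝ)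
  (B : Finset St) (w₀ : St → ℝ) (hw₀0 : ∀ y, 0 ≤ w₀ y)
  (hw₀ : ∀ x ∈ B, 1 + ((∑ b ∈ univ.filter (fun b => tgt b = x), c b ^ 2 * w₀ (src b)) +
      ∑ b ∈ univ.filter (fun b => src b = x), c b ^ 2 * w₀ (tgt b)) ≤
    ((∑ b ∈ univ.filter (fun b => tgt b = x), c b ^ 2) + ∑ b ∈ univ.filter (fun b => src b = x), c b ^ 2) * w₀ x)

include hw₀0 hw₀

/-- **SIZE OF THE DIRICHLET POTENTIAL**: `|g| ≤ m′` on `B` (`m′ ≥ 0`) ⟹ `|dirSol B g x| ≤ m′·w₀ x` for every `x` (`±dirSol B g − m′·w₀` are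
sub-solutions on `B`, nonpositive off `B`). [folklore] -/
theorem abs_dirSol_le (g : St → ℝ) {m' : ℝ} (hm' : 0 ≤ m') (hg : ∀ x ∈ B, |g x| ≤ m') (x : St) :
    |dirSol src tgt c B g x| ≤ m' * w₀ x := by
  have key : ∀ (σ : ℝ), (σ = 1 ∨ σ = -1) → σ * dirSol src tgt c B g x - m' * w₀ x ≤ 0 := by
    intro σ hσ
    have hσ1 : |σ| = 1 := by rcases hσ with h | h <;> simp [h]
    refine nonpos_of_subsolution_unit src tgt c B w₀ hw₀0 hw₀ (fun y => σ * dirSol src tgt c B g y - m' * w₀ y) ?_ ?_ x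
    · intro y hy
      rw [nb_sub src tgt c (fun z => σ * dirSol src tgt c B g z) (fun z => m' * w₀ z) y,
        nb_smul src tgt c σ (dirSol src tgt c B g) y, nb_smul src tgt c m' w₀ y]
      have h1 := dirSol_eq_on src tgt c B w₀ hw₀0 hw₀ g y hy
      have h2 := hw₀ y hy
      have h3 : σ * g y ≤ m' := by
        have := hg y hy
        have h4 : σ * g y ≤ |σ * g y| := le_abs_self _
        rw [abs_mul, hσ1, one_mul] at h4
        linarith
      have h4 : m' * 1 ≤ m' * (((∑ b ∈ univ.filter (fun b => tgt b = y), c b ^ 2) + ∑ b ∈ univ.filter (fun b => src b = y), c b ^ 2) * w₀ y -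
          ((∑ b ∈ univ.filter (fun b => tgt b = y), c b ^ 2 * w₀ (src b)) + ∑ b ∈ univ.filter (fun b => src b = y), c b ^ 2 * w₀ (tgt b))) :=
        mul_le_mul_of_nonneg_left (by linarith) hm'
      have h5 : σ * (((∑ b ∈ univ.filter (fun b => tgt b = y), c b ^ 2) + ∑ b ∈ univ.filter (fun b => src b = y), c b ^ 2) *
          dirSol src tgt c B g y) - σ * ((∑ b ∈ univ.filter (fun b => tgt b = y), c b ^ 2 * dirSol src tgt c B g (src b)) +
          ∑ b ∈ univ.filter (fun b => src b = y), c b ^ 2 * dirSol src tgt c B g (tgt b)) = σ * g y := by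
        rw [← h1]; ring
      linarith
    · intro y hy
      show σ * dirSol src tgt c B g y - m' * w₀ y ≤ 0
      rw [dirSol_eq_off src tgt c B w₀ hw₀0 hw₀ g y hy, mul_zero, zero_sub, neg_nonpos]
      exact mul_nonneg hm' (hw₀0 y)
  rw [abs_le]
  have h1 := key 1 (Or.inl rfl)
  have h2 := key (-1) (Or.inr rfl)
  constructor <;> linarith

/-- **GREEN REPRESENTATION**: `dirSol B g x = Σ_{y ∈ B} g(y)·green B x y`. [folklore] -/
theorem dirSol_eq_sum_green (g : St → ℝ) (x : St) :
    dirSol src tgt c B g x = ∑ y ∈ B, g y * green src tgt c B x y := by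
  classical
  -- `dirSol B g` solves the Dirichlet problem with the source `Σ_{y∈B} g(y)·δ_y`, which equals `g` on `B`
  have hsrc : dirSol src tgt c B g = dirSol src tgt c B (fun z => ∑ y ∈ B, g y * (if z = y then (1 : ℝ) else 0)) := by
    refine dirSol_unique src tgt c B w₀ hw₀0 hw₀ _ _ (fun z hz => dirSol_eq_off src tgt c B w₀ hw₀0 hw₀ g z hz) (fun z hz => ?_)
    rw [dirSol_eq_on src tgt c B w₀ hw₀0 hw₀ g z hz]
    simp only [mul_ite, mul_one, mul_zero, Finset.sum_ite_eq, if_pos hz]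
  rw [hsrc, dirSol_sum src tgt c B w₀ hw₀0 hw₀ B g (fun y z => if z = y then (1 : ℝ) else 0)]
  simp only [green]

omit hw₀0 hw₀ in
/-- **THE HARMONIC REMAINDER**: `f − dirSol B (W·f − Nf)` is harmonic on `B`. [folklore] -/
theorem sub_dirSol_harmonic (f : St → ℝ) (hw₀0 : ∀ y, 0 ≤ w₀ y)
    (hw₀ : ∀ x ∈ B, 1 + ((∑ b ∈ univ.filter (fun b => tgt b = x), c b ^ 2 * w₀ (src b)) +
        ∑ b ∈ univ.filter (fun b => src b = x), c b ^ 2 * w₀ (tgt b)) ≤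
      ((∑ b ∈ univ.filter (fun b => tgt b = x), c b ^ 2) + ∑ b ∈ univ.filter (fun b => src b = x), c b ^ 2) * w₀ x)
    (x : St) (hx : x ∈ B) :
    ((∑ b ∈ univ.filter (fun b => tgt b = x), c b ^ 2) + ∑ b ∈ univ.filter (fun b => src b = x), c b ^ 2) *
        (f x - dirSol src tgt c B (fun z => ((∑ b ∈ univ.filter (fun b => tgt b = z), c b ^ 2) +
            ∑ b ∈ univ.filter (fun b => src b = z), c b ^ 2) * f z -
          ((∑ b ∈ univ.filter (fun b => tgt b = z), c b ^ 2 * f (src b)) + ∑ b ∈ univ.filter (fun b => src b = z), c b ^ 2 * f (tgt b)))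
          x) =
      ((∑ b ∈ univ.filter (fun b => tgt b = x), c b ^ 2 *
            (f (src b) - dirSol src tgt c B (fun z => ((∑ b ∈ univ.filter (fun b => tgt b = z), c b ^ 2) +
                ∑ b ∈ univ.filter (fun b => src b = z), c b ^ 2) * f z -
              ((∑ b ∈ univ.filter (fun b => tgt b = z), c b ^ 2 * f (src b)) +
                ∑ b ∈ univ.filter (fun b => src b = z), c b ^ 2 * f (tgt b))) (src b))) +
        ∑ b ∈ univ.filter (fun b => src b = x), c b ^ 2 *
            (f (tgt b) - dirSol src tgt c B (fun z => ((∑ b ∈ univ.filter (fun b => tgt b = z), c b ^ 2) +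
                ∑ b ∈ univ.filter (fun b => src b = z), c b ^ 2) * f z -
              ((∑ b ∈ univ.filter (fun b => tgt b = z), c b ^ 2 * f (src b)) +
                ∑ b ∈ univ.filter (fun b => src b = z), c b ^ 2 * f (tgt b))) (tgt b))) := by
  set g : St → ℝ := fun z => ((∑ b ∈ univ.filter (fun b => tgt b = z), c b ^ 2) +
      ∑ b ∈ univ.filter (fun b => src b = z), c b ^ 2) * f z -
    ((∑ b ∈ univ.filter (fun b => tgt b = z), c b ^ 2 * f (src b)) + ∑ b ∈ univ.filter (fun b => src b = z), c b ^ 2 * f (tgt b))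
    with hg
  have h1 := dirSol_eq_on src tgt c B w₀ hw₀0 hw₀ g x hx
  rw [nb_sub src tgt c f (dirSol src tgt c B g) x, mul_sub]
  have hgx : g x = ((∑ b ∈ univ.filter (fun b => tgt b = x), c b ^ 2) + ∑ b ∈ univ.filter (fun b => src b = x), c b ^ 2) * f x -
      ((∑ b ∈ univ.filter (fun b => tgt b = x), c b ^ 2 * f (src b)) + ∑ b ∈ univ.filter (fun b => src b = x), c b ^ 2 * f (tgt b)) :=
    rfl
  linarith

end Generic

/-! ## §2 The gradient member on a torus box -/

section Torus

variable {d : ℕ} {N : Fin d → ℕ} [∀ i, NeZero (N i)]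

/-- **THE GRADIENT MEMBER (3.42)₂'s SHAPE ON A TORUS BOX (free Laplacian, constant weight `c ≡ c₀ ≠ 0`, flat transport).**
`R ≥ 1`, `10R + 4 ≤ N_i`, `B = {dist(·,x₀) ≤ 2R+2}`; the pointwise Green hypothesis `green B x′ y ≤ K·((dist x′ y + 1)^{d−2})⁻¹` (`K ≥ 0`;
for `d = 4` road P3's Newton-potential bound); `|f| ≤ M` and `|W·f − Nf| ≤ m′` (`m′ ≥ 0`) on `B`.  Then for every axis `μ`:
`|f(x₀+e_μ) − f(x₀)| ≤ K_d·M∕(R+1) + ((9/2)·K_d∕c₀² + 12·C₁·C_ps·K)·(R+1)·m′` — versus the sup member's `M`-free `(R+1)²·m′`: the gradient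
of a solution at scale `R` is one power of `R` smaller.  Proof: `f = f_h + dirSol_B(W·f − Nf)`; GR1 on `f_h` (harmonic on `B`,
`|f_h| ≤ M + m′(2R+3)²∕(2c₀²)`), GR2's dipole row sum on the potential part.
[cite: Balaban1985BackgroundPropagators, Thm 3.1 (3.42) p.397; Balaban1983RegularityDecay, Lemma 2.2 (2.17) p.577] [folklore] -/
theorem fdiff_le_box [NeZero d] {c : UT N × Fin d → ℝ} {c₀ : ℝ} (hc : ∀ b, c b = c₀) (hc₀ : c₀ ≠ 0) (x₀ : UT N) {R : ℕ}
    (hR : 1 ≤ R) (hN : ∀ i, 10 * R + 4 ≤ N i) {K : ℝ} (hK : 0 ≤ K)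
    (hG : ∀ x' y : UT N, green bsrc btgt c (univ.filter (fun y : UT N => dist y x₀ ≤ 2 * R + 2)) x' y ≤
      K * ((dist x' y + 1) ^ (d - 2))⁻¹)
    (f : UT N → ℝ) {M m' : ℝ} (hm' : 0 ≤ m')
    (hM : ∀ y ∈ univ.filter (fun y : UT N => dist y x₀ ≤ 2 * R + 2), |f y| ≤ M)
    (hsrc : ∀ y ∈ univ.filter (fun y : UT N => dist y x₀ ≤ 2 * R + 2),
      |((∑ b ∈ univ.filter (fun b : UT N × Fin d => btgt b = y), c b ^ 2) +
            ∑ b ∈ univ.filter (fun b : UT N × Fin d => bsrc b = y), c b ^ 2) * f y -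
          ((∑ b ∈ univ.filter (fun b : UT N × Fin d => btgt b = y), c b ^ 2 * f (bsrc b)) +
            ∑ b ∈ univ.filter (fun b : UT N × Fin d => bsrc b = y), c b ^ 2 * f (btgt b))| ≤ m')
    (μ : Fin d) :
    |f (up x₀ μ) - f x₀| ≤
      Kgrad d * M / ((R : ℝ) + 1) + (9 / 2 * Kgrad d / c₀ ^ 2 + 12 * Cdip d * Cps d * K) * ((R : ℝ) + 1) * m' := by
  classical
  have hd1 : 1 ≤ d := Nat.one_le_iff_ne_zero.mpr (NeZero.ne d)
  set B := univ.filter (fun y : UT N => dist y x₀ ≤ 2 * R + 2) with hB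
  -- the Laplacian of `f`, its Dirichlet potential, the harmonic remainder
  set g : UT N → ℝ := fun z => ((∑ b ∈ univ.filter (fun b : UT N × Fin d => btgt b = z), c b ^ 2) +
      ∑ b ∈ univ.filter (fun b : UT N × Fin d => bsrc b = z), c b ^ 2) * f z -
    ((∑ b ∈ univ.filter (fun b : UT N × Fin d => btgt b = z), c b ^ 2 * f (bsrc b)) +
      ∑ b ∈ univ.filter (fun b : UT N × Fin d => bsrc b = z), c b ^ 2 * f (btgt b)) with hg
  set fg : UT N → ℝ := dirSol bsrc btgt c B g with hfg
  set fh : UT N → ℝ := fun z => f z - fg z with hfh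
  -- the unit supersolution of the box of radius `2R+2`
  have hr : ∀ ν, 2 * (2 * R + 2) + 2 ≤ N ν := fun ν => by have := hN ν; omega
  obtain ⟨w₀, hw₀0, hw₀le, hw₀⟩ := exists_unit_supersolution_box hc hc₀ x₀ hr
  have ecast : (((2 * R + 2 : ℕ) : ℝ)) = 2 * (R : ℝ) + 2 := by push_cast; ring
  have eB : univ.filter (fun y : UT N => dist y x₀ ≤ ((2 * R + 2 : ℕ) : ℝ)) = B := by rw [hB, ecast]
  rw [eB] at hw₀
  have hR0 : (0 : ℝ) < (R : ℝ) + 1 := by positivity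
  have hx₀B : x₀ ∈ B := Finset.mem_filter.mpr ⟨Finset.mem_univ _, by rw [dist_self]; positivity⟩
  have hM0 : 0 ≤ M := (abs_nonneg _).trans (hM x₀ hx₀B)
  -- size of the potential part everywhere
  have hfg_le : ∀ y, |fg y| ≤ m' * ((((2 * R + 2 : ℕ) : ℝ) + 1) ^ 2 / (2 * c₀ ^ 2)) := by
    intro y
    refine (abs_dirSol_le bsrc btgt c B w₀ hw₀0 hw₀ g hm' (fun z hz => hsrc z hz) y).trans ?_
    exact mul_le_mul_of_nonneg_left (hw₀le y) hm'
  have hq : (((2 * R + 2 : ℕ) : ℝ) + 1) ^ 2 / (2 * c₀ ^ 2) ≤ 9 / 2 * ((R : ℝ) + 1) ^ 2 / c₀ ^ 2 := by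
    have hc2 : (0 : ℝ) < c₀ ^ 2 := by positivity
    have hsq : (((2 * R + 2 : ℕ) : ℝ) + 1) ^ 2 ≤ 9 * ((R : ℝ) + 1) ^ 2 := by rw [ecast]; nlinarith
    calc (((2 * R + 2 : ℕ) : ℝ) + 1) ^ 2 / (2 * c₀ ^ 2) ≤ 9 * ((R : ℝ) + 1) ^ 2 / (2 * c₀ ^ 2) :=
          div_le_div_of_nonneg_right hsq (by positivity)
      _ = 9 / 2 * ((R : ℝ) + 1) ^ 2 / c₀ ^ 2 := by field_simp
  -- (a) the harmonic part by GR1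
  have hfh_harm : ∀ y ∈ univ.filter (fun y : UT N => dist y x₀ ≤ 2 * R + 2),
      ((∑ b ∈ univ.filter (fun b : UT N × Fin d => btgt b = y), c b ^ 2) +
          ∑ b ∈ univ.filter (fun b : UT N × Fin d => bsrc b = y), c b ^ 2) * fh y =
        ((∑ b ∈ univ.filter (fun b : UT N × Fin d => btgt b = y), c b ^ 2 * fh (bsrc b)) +
          ∑ b ∈ univ.filter (fun b : UT N × Fin d => bsrc b = y), c b ^ 2 * fh (btgt b)) :=
    fun y hy => sub_dirSol_harmonic bsrc btgt c B w₀ f hw₀0 hw₀ y hy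
  have hfh_bd : ∀ y ∈ univ.filter (fun y : UT N => dist y x₀ ≤ 2 * R + 2),
      |fh y| ≤ M + m' * (9 / 2 * ((R : ℝ) + 1) ^ 2 / c₀ ^ 2) := by
    intro y hy
    have h1 := hM y hy
    have h2 := (hfg_le y).trans (mul_le_mul_of_nonneg_left hq hm')
    calc |fh y| = |f y - fg y| := rfl
      _ ≤ |f y| + |fg y| := abs_sub _ _
      _ ≤ M + m' * (9 / 2 * ((R : ℝ) + 1) ^ 2 / c₀ ^ 2) := add_le_add h1 h2
  have hA := harmonic_fdiff_le hc hc₀ x₀ hR hN fh hfh_harm hfh_bd μ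
  -- (b) the potential part by GR2's dipole row sum
  have hrep : ∀ z, fg z = ∑ y ∈ B, g y * green bsrc btgt c B z y :=
    fun z => dirSol_eq_sum_green bsrc btgt c B w₀ hw₀0 hw₀ g z
  have hball : ∀ x' : UT N, dist x' x₀ ≤ 2 * R + 2 → x' ∈ B := fun x' hx' => Finset.mem_filter.mpr ⟨Finset.mem_univ _, hx'⟩
  have hBD : ∀ y ∈ B, dist x₀ y ≤ ((2 * R + 2 : ℕ) : ℝ) := by
    intro y hy
    rw [ecast, dist_comm]
    exact (Finset.mem_filter.mp hy).2
  have hrow := sum_abs_fdiff_green_le hc hc₀ B w₀ hw₀0 hw₀ hK hG x₀ hR hN hball hBD μ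
  have hBsum : |fg (up x₀ μ) - fg x₀| ≤ m' * (Cdip d * Cps d * K * ((((2 * R + 2 : ℕ) : ℝ)) + 1) *
      (1 + ((((2 * R + 2 : ℕ) : ℝ)) + 1) / ((R : ℝ) + 1))) := by
    rw [hrep (up x₀ μ), hrep x₀, ← Finset.sum_sub_distrib]
    calc |∑ y ∈ B, (g y * green bsrc btgt c B (up x₀ μ) y - g y * green bsrc btgt c B x₀ y)|
        ≤ ∑ y ∈ B, |g y * green bsrc btgt c B (up x₀ μ) y - g y * green bsrc btgt c B x₀ y| := abs_sum_le_sum_abs _ _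
      _ = ∑ y ∈ B, |g y| * |green bsrc btgt c B (up x₀ μ) y - green bsrc btgt c B x₀ y| :=
          Finset.sum_congr rfl fun y _ => by rw [← mul_sub, abs_mul]
      _ ≤ ∑ y ∈ B, m' * |green bsrc btgt c B (up x₀ μ) y - green bsrc btgt c B x₀ y| :=
          Finset.sum_le_sum fun y hy => mul_le_mul_of_nonneg_right (hsrc y hy) (abs_nonneg _)
      _ = m' * ∑ y ∈ B, |green bsrc btgt c B (up x₀ μ) y - green bsrc btgt c B x₀ y| := by rw [Finset.mul_sum]
      _ ≤ _ := mul_le_mul_of_nonneg_left hrow hm'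
  -- `(2R+3)(1 + (2R+3)/(R+1)) ≤ 12(R+1)`
  have hgeom : ((((2 * R + 2 : ℕ) : ℝ)) + 1) * (1 + ((((2 * R + 2 : ℕ) : ℝ)) + 1) / ((R : ℝ) + 1)) ≤ 12 * ((R : ℝ) + 1) := by
    rw [ecast]
    have h1 : (2 * (R : ℝ) + 2 + 1) / ((R : ℝ) + 1) ≤ 3 := by
      rw [div_le_iff₀ hR0]; linarith
    have h2 : 0 ≤ 2 * (R : ℝ) + 2 + 1 := by positivity
    nlinarith
  have hCC : 0 ≤ Cdip d * Cps d * K := mul_nonneg (mul_nonneg (Cdip_nonneg hd1) (Cps_nonneg d)) hK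
  have hB' : |fg (up x₀ μ) - fg x₀| ≤ 12 * Cdip d * Cps d * K * ((R : ℝ) + 1) * m' := by
    refine hBsum.trans ?_
    have := mul_le_mul_of_nonneg_left hgeom hCC
    nlinarith
  -- assembly
  have hsplit : f (up x₀ μ) - f x₀ = (fh (up x₀ μ) - fh x₀) + (fg (up x₀ μ) - fg x₀) := by
    simp only [hfh]; ring
  have hKg := Kgrad_nonneg hd1
  have hA' : Kgrad d * (M + m' * (9 / 2 * ((R : ℝ) + 1) ^ 2 / c₀ ^ 2)) / ((R : ℝ) + 1) =
      Kgrad d * M / ((R : ℝ) + 1) + 9 / 2 * Kgrad d / c₀ ^ 2 * ((R : ℝ) + 1) * m' := by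
    have hc2 : c₀ ^ 2 ≠ 0 := by positivity
    have hR1 : (R : ℝ) + 1 ≠ 0 := hR0.ne'
    field_simp
  rw [hsplit]
  calc |fh (up x₀ μ) - fh x₀ + (fg (up x₀ μ) - fg x₀)|
      ≤ |fh (up x₀ μ) - fh x₀| + |fg (up x₀ μ) - fg x₀| := abs_add_le _ _
    _ ≤ Kgrad d * (M + m' * (9 / 2 * ((R : ℝ) + 1) ^ 2 / c₀ ^ 2)) / ((R : ℝ) + 1) +
          12 * Cdip d * Cps d * K * ((R : ℝ) + 1) * m' := add_le_add hA hB'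
    _ = Kgrad d * M / ((R : ℝ) + 1) + (9 / 2 * Kgrad d / c₀ ^ 2 + 12 * Cdip d * Cps d * K) * ((R : ℝ) + 1) * m' := by
          rw [hA']; ring

end Torus

end

end Summit.QuantumFields.BalabanUV.Beta.GradientMemberBox
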